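import Literature.IUT.HodgeArakelov.GoodPrimeKummerBridge
import Literature.IUT.HodgeArakelov.AbsTopMonoidsGaloisPairBridge
import HarnessLib

/-!
# [IUTchII] Prop 4.2 (i), (ii) [unit part] — unconditional instances and the junction with Ex 1.8's pairs
# (proof-only companion of `GoodPrimeKummerBridge.lean`)

S. Mochizuki, *Inter-universal Teichmüller theory II*, §4, kurims manuscript (Dec. 2020), Proposition 4.2
(i), (ii) p. 124 and Remark 4.2.1 (i) pp. 125–126 (lit key `paper:url-5036b4059555`)
[cite: Mochizuki2012, Prop 4.2 p.123]. Claim key DISPUTED (D-0012). PROOF-ONLY companion (0 definitions)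
of `GoodPrimeKummerBridge.lean` (abc-iut-L6-t5; `GoodPrimeKummer.Prop42i`, `GoodPrimeKummer.Prop42iiUnit`).

* NON-VACUITY / unconditional instances: over the identity identification of ONE MLF-Galois `TM`-pair
  (resp. `TCG`-pair) with itself, `Prop42i` (resp. `Prop42iiUnit`) HOLDS with no lifting hypothesis — the
  identity is an equivariant isomorphism, uniqueness (resp. the torsor structure) is proved in the
  companion (`prop42i_self`, `prop42iiUnit_self`).
* JUNCTION with abc-iut-L6-t1's [IUTchII] Ex 1.8 (ii) pairs `(G ↷ O^⊳(G))` (bridge B9 (a),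
  `AbsTopMonoids.toPair`, abc-iut-L6-t7): Remark 4.2.1 (i) p. 126 "one has analogues of «`Ψ^ss_{†F^⊢_v}`» and
  of Proposition 4.2, (i), (ii), in the case of `v ∈ V^bad`" — the (i)-analogue between any two objects of
  the connected groupoid `IsoClass G_v`, from the SAME two named statements that give Rmk 1.11.1 (i)(a)
  (`Rmk1111_a_of_monoAnalyticLifts`, abc-iut-L6-t23/w5): `prop42i_toPair_of_monoAnalyticLifts`.

HONEST FRAMING: nothing here bears on [IUTchIII] Cor. 3.12 or takes a side; typed ≠ discharged elsewhere.
-/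

namespace Literature.IUT.HodgeArakelov

open CategoryTheory
open Literature.AnabelianGeometry.AbsoluteAnabelian

namespace GoodPrimeKummer

/-- **Non-vacuity of `Prop42i`, unconditional**: an MLF-Galois `TM`-pair has EXACTLY ONE equivariant
automorphism of its monoid over the identity of its group — the identity ([IUTchII] Prop 4.2 (i) p. 124
with `†F_v` and `Ψ_cns(†Π_v)` taken to be the same pair; uniqueness = [AbsTopIII] Prop 3.2 (iv), proved).
[cite: Mochizuki2012, Prop 4.2 (i) p.124] -/
theorem prop42i_self {P : GaloisMonoidPair.{0}} (hP : IsMLFGaloisMonoidPair .TM P) :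
    Prop42i P P (ContinuousMulEquiv.refl P.Pi) :=
  prop42i_of_exists_lift hP hP _ ⟨GaloisMonoidPair.Iso.refl P, rfl⟩

/-- **Non-vacuity of `Prop42iiUnit`, unconditional**: over the identity of the group of an MLF-Galois
`TCG`-pair, every automorphism of the cyclotome is induced by exactly one equivariant group automorphism
(the `Ẑ^×`-torsor of [IUTchII] Prop 4.2 (ii) p. 124 / Rmk 1.11.1 (i)(b), here with no lifting hypothesis:
the identity is one member, the torsor structure is proved). [cite: Mochizuki2012, Prop 4.2 (ii) p.124] -/
theorem prop42iiUnit_self {P : GaloisMonoidPair.{0}} (hP : IsMLFGaloisMonoidPair .TCG P) :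
    Prop42iiUnit P P (ContinuousMulEquiv.refl P.Pi) :=
  prop42iiUnit_of_exists hP hP _ ⟨MulEquiv.refl P.M, refl_mem_equivariantIsoOver P⟩

variable {S : ThetaSetting.{0}} (A : AbsTopMonoids S) (hA : A.ContinuityLaws)

/-- **[IUTchII] Rmk 4.2.1 (i)** (p. 126: "one has analogues of «`Ψ^ss_{†F^⊢_v}`» and of Proposition 4.2, (i),
(ii), in the case of `v ∈ V^bad`"), the (i)-analogue on abc-iut-L6-t1's Ex 1.8 (ii) pairs `(G ↷ O^⊳(G))`: for
any two objects `G`, `H` of the connected groupoid `IsoClass G_v` and any isomorphism `f : G ⟶ H`, there is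
EXACTLY ONE `f`-equivariant isomorphism of monoids `O^⊳(G) ⥲ O^⊳(H)` — from the mono-analytic lifting statement
`GaloisIsoLiftsToTMPairIsoOfMonoAnalytic` BY NAME (as for Rmk 1.11.1 (i)(a)) and the merged reading that the
pairs are MLF-Galois `TM`-pairs of mono-analytic type. [cite: Mochizuki2012, Rmk 4.2.1 (i) p.126] -/
theorem prop42i_toPair_of_monoAnalyticLifts (hlift : GaloisIsoLiftsToTMPairIsoOfMonoAnalytic)
    (hTM : ∀ G, A.IsTMPair hA G) (hMA : ∀ G, IsOfMonoAnalyticTypeMonoid .TM (A.toPair hA G))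
    {G H : IsoClass S.Gk} (f : G ⟶ H) :
    Prop42i (A.toPair hA G) (A.toPair hA H) (IsoClass.homIso f) :=
  prop42i_of_monoAnalyticLifts hlift (hTM G) (hTM H) (hMA G) (hMA H) (IsoClass.homIso f)

/-- … and then the unique `f`-equivariant isomorphism IS abc-iut-L6-t1's transport `mapOtri f` (its
functoriality datum), by uniqueness. [cite: Mochizuki2012, Rmk 4.2.1 (i) p.126] -/
theorem mapOtri_mem_equivariantIsoOver {G H : IsoClass S.Gk} (f : G ⟶ H) :
    A.mapOtri f ∈ equivariantIsoOver (A.toPair hA G) (A.toPair hA H) (IsoClass.homIso f) :=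
  isoM_mem_equivariantIsoOver (A.mapPairIso hA f)

/-- Uniqueness in Rmk 4.2.1 (i)'s (i)-analogue, unconditional: any `f`-equivariant isomorphism
`O^⊳(G) ⥲ O^⊳(H)` between MLF-Galois `TM`-pairs of the groupoid equals `mapOtri f`.
[cite: Mochizuki2012, Rmk 4.2.1 (i) p.126] -/
theorem eq_mapOtri_of_mem_equivariantIsoOver (hTM : ∀ G, A.IsTMPair hA G) {G H : IsoClass S.Gk} (f : G ⟶ H)
    {φ : A.Otri G ≃* A.Otri H}
    (hφ : φ ∈ equivariantIsoOver (A.toPair hA G) (A.toPair hA H) (IsoClass.homIso f)) :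
    φ = A.mapOtri f :=
  equivariantIsoOver_subsingleton (hTM G) (hTM H) (IsoClass.homIso f) hφ
    (mapOtri_mem_equivariantIsoOver A hA f)

end GoodPrimeKummer

end Literature.IUT.HodgeArakelov
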